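import Summits.Langlands.Langlands.Theorems.LevelOneDyadicTensorCoreKernels
import Literature.NumberTheory.GaloisRepresentations.ToLocalRestrictField
import Literature.RepresentationTheory.Semisimple.SubrepresentationEquiv

/-!
# Level-one dyadic companions, part 7: the POTENTIAL normal form of the minimal Lie-irreducible counterexample —
# Brauer–Taylor descent separates «potential companions on solvable layers» (the residual) from a PRINT descent mechanism

decomp-langlands lens-4 (minimal counterexample / extremal reduction) g11 node `PotentialNormalForm`
(HOME/nodes/lens-4-g11-PotentialNormalForm.lean).  Tree-landable twin shape: imports part 5 (`LevelOneDyadicClifford`, landed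
p770885) and two Literature modules (restriction plumbing `ToLocalRestrictField`, which carries the named fact `DeRhamBaseChange`, and
`Semisimple.SubrepresentationEquiv` for `Representation.isIrreducible_of_equiv`); no route-file import; 0 sorry; axioms standard.
(The named fact `Literature.NumberTheory.PAdicHodge.CrystallineBaseChange` is consumed through a hypothesis carrying its statement
VERBATIM — that module was unbuilt on the Lean farm on 2026-08-30, rc 75 `unbuilt:…CrystallineBaseChange`, so it is not imported.)

TARGET (RESIDUAL MODE, the lineage's declared residual after g9/g10): R = `Clifford.LieIrreducibleCompanion` — a Lie-irreducible,
irreducible, level-one crystalline ρ : Γ_K → GL_n(ℚ̄_ℓ) (ℓ odd) has, for every ι₂ : ℚ̄₂ ≅ ℂ, a continuous a.e.-unramified 2-adic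
companion.  (T = `DyadicContinuousCompanion` = stmt-Langlands-31993 ⟺ R ∧ D′, part 5.)

EXTREMAL REDUCTION.  Call a counterexample ρ to R PERSISTENT if for EVERY finite Galois L/K some solvable layer K ⊆ M ⊆ L
(Gal(L/M) solvable) still carries no companion of ρ|Γ_M.  The node proves: every counterexample is persistent — modulo two PRINT
statements (Brauer–Taylor descent BT, level-one heredity HER) and the two existing Galois-side items G (`DyadicDeRhamRigidity`, 31994) and
I (`DyadicIrreducibilityTransfer`, 31934).  Hence R ⟸ PC ∧ BT ∧ HER ∧ G ∧ I with the NEW DECLARED RESIDUAL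
PC = «no persistent counterexample» = POTENTIAL COMPANIONS ON SOLVABLE LAYERS, and R ⟹ PC outright (`potentialCompanions_of_R`):
the split is EXACT modulo the print/attackable pieces (`lieIrreducibleCompanion_iff_potential`).

## New pieces (one-line texts over tree declarations; vocabulary bridges are `Iff.rfl`)
* PC = `PotentialCompanions` (crux · DECLARED RESIDUAL · WEAKER than R, T, E, Langlands by kernel): for ρ as in R and every ι₂ there is
  a finite Galois L/K such that on every solvable layer M (K ⊆ M ⊆ L, Gal(L/M) solvable) on which ρ|Γ_M is level one (it always is: HER)
  ρ|Γ_M has a dyadic companion through (ι, ι₂).  PRINT on the polarizable regular potentially-diagonalizable sector by POTENTIAL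
  AUTOMORPHY ALONE (BLGGT Thm 4.5.1 + BLGHT Lemma 1.4 soluble descent of RAESDC π) — no Brauer argument, no compatible system needed.
* BT = `BrauerTaylorDescent` (support · PRINT · pure representation theory + Chebotarev): ρ : Γ_K → GL_n(ℚ̄_ℓ) continuous, L/K finite Galois;
  if ρ|Γ_M has an a.e.-unramified 2-adic companion on every solvable layer M of L/K and EVERY a.e.-unramified 2-adic companion of ρ|Γ_L is
  irreducible, then ρ has an a.e.-unramified 2-adic companion over K.  Proof in print = the proof of BLGGT Thm 5.4.1 (arXiv:1010.2561
  pp. 39–40) / Harris–Shepherd-Barron–Taylor Thm 4.2 / Taylor (FM conjecture remarks) with «r automorphic over F_i» replaced by «companion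
  over M_i»: Brauer 1 = Σ nᵢ Ind ψᵢ on Gal(L/K) with L/Mᵢ solvable (elementary), A := Σ nᵢ Ind_{Mᵢ}^K (ρ₂^{(Mᵢ)} ⊗ ι₂⁻¹ιψᵢ) ∈ Groth(Γ_K, ℚ̄₂);
  (A, A) = (1, 1)_{Gal(L/K)} = 1 by Mackey, because on each Mackey layer H′ = Γ_{Mⱼ} ∩ σΓ_{Mᵢ}σ⁻¹ ⊇ Γ_L the two restricted companions are
  IRREDUCIBLE (their restriction to Γ_L is a companion of ρ|Γ_L) companions of the same ρ|Γ_{M′}, hence conjugate (Chebotarev + Brauer–Nesbitt,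
  tree `exists_conj_of_match`), and End_{Γ_L} = scalars; dim A = n > 0 ⟹ A = [r₂], r₂ irreducible; tr r₂(Frob_v^k) = ι₂⁻¹ι tr ρ(Frob_v^k)
  by the induced-character formula read through the layer companions and 1 = Σ nᵢ Ind ψᵢ ⟹ Frobenius polynomials match a.e.
* HER = `LevelOneHeredity` (support · PRINT · KERNEL modulo the two NAMED Literature facts `DeRhamBaseChange` (Brinon–Conrad Prop. 6.3.8) and
  `CrystallineBaseChange` (Fontaine Exp. VIII §2.3.7): `levelOneHeredity_of_baseChange`): pinned-geometric ∧ crystalline above ℓ ∧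
  unramified away from ℓ pass from ρ to ρ|Γ_L for every number field L ⊇ K (tree plumbing `isDeRhamFramed_toLocal_restrictField`,
  `isCrystallineFramed_toLocal_restrictField`, `FramedGaloisRep.isUnramifiedAt_restrictField`).

## Kernels (0 sorry, axioms standard)
R ⟸ PC ∧ BT ∧ HER ∧ G ∧ I (`lieIrreducibleCompanion_of_pieces`: G and I over L make every companion of ρ|Γ_L irreducible, HER feeds
their level-one hypotheses and PC's guards, BT descends); R ⟹ PC (`potentialCompanions_of_R`, via Lie-irreducibility of ρ|Γ_M:
`isLieIrreducible_restrictField`, tower conjugacy `SorensenPatching.nonempty_equiv_restrictField_restrictField`); T ⟹ PC, E ⟹ PC,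
Langlands ⟹ PC; R ⟺ PC mod (BT, HER, G, I) (`lieIrreducibleCompanion_iff_potential`); HER ⟸ DeRhamBaseChange ∧ CrystallineBaseChange;
T ⟸ PC ∧ BT ∧ HER ∧ G ∧ I ∧ D′ and T ⟺ PC ∧ D′ mod (BT, HER, G, I); E ⟸ …; `langlands_of_pieces₁₁` (17 binders, through part 5's
`langlands_of_pieces₉`).
Sources: T. Barnet-Lamb, T. Gee, D. Geraghty, R. Taylor, *Potential automorphy and change of weight*, Ann. of Math. 179 (2014) =
arXiv:1010.2561, Thm 4.5.1, Thm 5.4.1 and its proof [corpus:paper:arxiv-1010.2561 p.39–40]; T. Barnet-Lamb, D. Geraghty, M. Harris,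
R. Taylor, *A family of Calabi–Yau varieties and potential automorphy II*, PRIMS 47 (2011), Lemma 1.4; M. Harris, N. Shepherd-Barron,
R. Taylor, *A family of Calabi–Yau varieties and potential automorphy*, Ann. of Math. 171 (2010) Thm 4.2; R. Brauer, Ann. of Math. 48
(1947) (induction theorem); J.-P. Serre, *Linear representations of finite groups* §10 Thm 19; C. Khare, *Serre's modularity
conjecture* survey in Burns–Buzzard–Nekovář (eds.), *L-functions and Galois representations* (CUP 2007) p. 328 (the Brauer/Mackey
construction of compatible systems from potential modularity, after Taylor 2002/2006 and Dieulefait 2004) [corpus:book:burns2007-l-functions-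
galois-representations p.328]; H. Esnault, *Local systems in algebraic-arithmetic geometry* (2023) Lecture 7 §7.4.1 pp. 113–114
[corpus:book:esnault2023-local-systems-algebraic-arithmetic-geometry p.113–114]; O. Brinon, B. Conrad, CMI notes (2009) Prop. 6.3.8;
J.-M. Fontaine, Astérisque 223 Exp. III §5.1, Exp. VIII §2.3.7.  No new definitions of mathematical objects beyond Props; no new axioms.
-/

set_option linter.dupNamespace false

namespace Summit.Langlands.Langlands.Theorems.LevelOneDyadic.Potential

open scoped NumberField
open Filter IsDedekindDomain
open Literature.NumberTheory.GaloisRepresentations Literature.NumberTheory.Automorphic Literature.NumberTheory.PAdicHodge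
open Summit.Langlands.Langlands.Theorems.LevelOneDyadic (IsPinnedGeometric IsCrystallineAbove IsUnramifiedAwayFrom IsDeRhamAbove
  CompanionMatch DyadicContinuousCompanion DyadicCompanionExistence DyadicDeRhamRigidity DyadicIrreducibilityTransfer
  DyadicLevelTransfer dyadicContinuousCompanion_iff dyadicDeRhamRigidity_iff dyadicIrreducibilityTransfer_iff
  dyadicContinuousCompanion_of_langlands dyadicContinuousCompanion_of_E dyadicCompanionExistence_of_TG eventually_natCast_notMem
  dyadicDeRhamRigidity_of_langlands dyadicIrreducibilityTransfer_of_langlands)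
open Summit.Langlands.Langlands.Theorems.LevelOneDyadic.Clifford (HasDyadicCompanion DimSlice IsLieIrreducible
  LieIrreducibleCompanion CliffordCompanionStep lieIrreducibleCompanion_iff cliffordCompanionStep_iff
  dyadicContinuousCompanion_of_pieces dyadicContinuousCompanion_iff_pieces dyadicCompanionExistence_of_pieces
  lieIrreducibleCompanion_of_T cliffordCompanionStep_of_T langlands_of_pieces₉)
open Summit.Langlands.Langlands.Theorems.LevelOneDyadic.TensorCore (ArtinTensorCore CliffordTateShapes cliffordCompanionStep_of_shapes
  langlands_of_pieces₁₀β)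

/-! ## Vocabulary (helper predicates; the filed texts inline them verbatim — bridges are `Iff.rfl`) -/

section Vocabulary

variable {K : Type} [Field K] [NumberField K] {ℓ : ℕ} [Fact ℓ.Prime] {n : ℕ}

/-- `ρ` is LEVEL ONE (at ℓ): pinned-geometric, crystalline above ℓ, unramified away from ℓ (the standing hypotheses of T). -/
def IsLevelOne (ρ : FramedGaloisRep K (PadicAlgCl ℓ) n) : Prop :=
  IsPinnedGeometric ρ ∧ IsCrystallineAbove ρ ∧ IsUnramifiedAwayFrom ρ

/-- COMPANIONS ON THE SOLVABLE LAYERS of a finite extension `L/K`: for every intermediate number field `K ⊆ M ⊆ L` (typed as a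
scalar tower) with `Gal(L/M) = L ≃ₐ[M] L` solvable, `ρ|Γ_M` has a dyadic companion through (ι, ι₂).  (BT's hypothesis (a).) -/
def LayerCompanions (ι : PadicAlgCl ℓ ≃+* ℂ) (ι₂ : PadicAlgCl 2 ≃+* ℂ) (ρ : FramedGaloisRep K (PadicAlgCl ℓ) n)
    (L : Type) [Field L] [Algebra K L] : Prop :=
  ∀ (M : Type) [Field M] [NumberField M] [Algebra K M] [Algebra M L] [IsScalarTower K M L], IsSolvable (L ≃ₐ[M] L) →
    HasDyadicCompanion ι ι₂ (ρ.restrictField M)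

/-- GUARDED companions on the solvable layers: as `LayerCompanions`, but only on the layers on which `ρ|Γ_M` is level one
(which is every layer, by `LevelOneHeredity`; the guard makes PC ⟸ R / T / Langlands unconditional).  (PC's conclusion.) -/
def GuardedLayerCompanions (ι : PadicAlgCl ℓ ≃+* ℂ) (ι₂ : PadicAlgCl 2 ≃+* ℂ) (ρ : FramedGaloisRep K (PadicAlgCl ℓ) n)
    (L : Type) [Field L] [Algebra K L] : Prop :=
  ∀ (M : Type) [Field M] [NumberField M] [Algebra K M] [Algebra M L] [IsScalarTower K M L], IsSolvable (L ≃ₐ[M] L) →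
    IsPinnedGeometric (ρ.restrictField M) → IsCrystallineAbove (ρ.restrictField M) → IsUnramifiedAwayFrom (ρ.restrictField M) →
      HasDyadicCompanion ι ι₂ (ρ.restrictField M)

/-- A GUARDED companion of `ρ|Γ_L`: if `ρ|Γ_L` is level one, it has a dyadic companion through (ι, ι₂).  (POT's conclusion.) -/
def GuardedCompanionOver (ι : PadicAlgCl ℓ ≃+* ℂ) (ι₂ : PadicAlgCl 2 ≃+* ℂ) (ρ : FramedGaloisRep K (PadicAlgCl ℓ) n)
    (L : Type) [Field L] [NumberField L] [Algebra K L] : Prop :=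
  IsPinnedGeometric (ρ.restrictField L) → IsCrystallineAbove (ρ.restrictField L) → IsUnramifiedAwayFrom (ρ.restrictField L) →
    HasDyadicCompanion ι ι₂ (ρ.restrictField L)

/-- EVERY a.e.-unramified dyadic companion of `σ` through (ι, ι₂) is irreducible.  (BT's hypothesis (b), for σ = ρ|Γ_L.) -/
def CompanionsIrreducible {L : Type} [Field L] [NumberField L] (ι : PadicAlgCl ℓ ≃+* ℂ) (ι₂ : PadicAlgCl 2 ≃+* ℂ)
    (σ : FramedGaloisRep L (PadicAlgCl ℓ) n) : Prop :=
  ∀ σ₂ : FramedGaloisRep L (PadicAlgCl 2) n, (∀ᶠ w : HeightOneSpectrum (𝓞 L) in cofinite, σ₂.IsUnramifiedAt w) →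
    CompanionMatch ι ι₂ σ σ₂ → σ₂.toGaloisRep.IsIrreducible

end Vocabulary

/-! ## The pieces — ONE-LINE self-contained Props over tree declarations (= the texts of `texts.json`) -/

/-- [crux · rank 2 · PC · THE NEW DECLARED RESIDUAL · WEAKER than R (`potentialCompanions_of_R`), than T (`…_of_T`), than E and than the
summit (`…_of_langlands`) · ORBIT-SATURATED (∃ L; closed under twists and finite base change of the class) · PRINT SECTOR: polarizable,
Hodge–Tate regular, potentially diagonalizable ρ over CM / totally real K with ℓ ≥ 2(n+1), ζ_ℓ ∉ K, ρ̄|Γ_{K(ζ_ℓ)} irreducible — BLGGT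
Thm 4.5.1 (potential automorphy over a CM F′/K linearly disjoint from K(ρ̄, ζ_ℓ)) + BLGHT Lemma 1.4 (soluble descent of the RAESDC π to
every F′ ⊇ M ⊇ K with F′/M soluble) + local–global compatibility at λ ∣ 2 · DARK CORE: non-polarizable / irregular / general K —
Deligne's companion problem over a number field, now asked only POTENTIALLY and only on solvable-topped layers]
POTENTIAL COMPANIONS ON SOLVABLE LAYERS: for ρ : Γ_K → GL_n(ℚ̄_ℓ) irreducible, LIE-IRREDUCIBLE, level one crystalline (ℓ odd) and
every ι₂ : ℚ̄₂ ≅ ℂ there is a finite Galois extension L/K such that for every intermediate number field K ⊆ M ⊆ L with Gal(L/M)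
solvable on which ρ|Γ_M is level one, ρ|Γ_M has a continuous a.e.-unramified 2-adic companion through (ι, ι₂).
Why it might fail: off the potential-automorphy sectors nothing produces a 2-adic avatar of an abstract crystalline ρ over ANY
finite extension (over number fields there is no analogue of L. Lafforgue's curve case from which Drinfeld's proof starts — Esnault 2023,
Lecture 7 §7.4.1); the ∃L weakening only removes the residual-image, ζ_ℓ and base-field obstructions that potential automorphy removes.
SHAPE PRECEDENT (function fields): Drinfeld's proof of Deligne's conjecture FIRST constructs the companion on a finite étale Galois cover
X′ → X and THEN descends (Esnault 2023 pp. 113–114, Claim 7.3 / Remark 7.4) — PC ∧ BT is the number-field shape of that two-step, with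
Taylor's Brauer argument (Khare's survey in Burns–Buzzard–Nekovář 2007 p. 328; BLGGT Thm 5.4.1) replacing the curve C ↠ Γ of Claim 7.3. -/
def PotentialCompanions : Prop :=
  ∀ (K : Type) [Field K] [NumberField K] (n : ℕ), 0 < n → ∀ (ℓ : ℕ) [Fact ℓ.Prime], ℓ ≠ 2 → ∀ (ι : PadicAlgCl ℓ ≃+* ℂ) (ρ : Literature.NumberTheory.GaloisRepresentations.FramedGaloisRep K (PadicAlgCl ℓ) n), ρ.toGaloisRep.IsIrreducible → (∀ (L : Type) [Field L] [NumberField L] [Algebra K L], (ρ.restrictField L).toGaloisRep.IsIrreducible) → ((∀ᶠ v : IsDedekindDomain.HeightOneSpectrum (NumberField.RingOfIntegers K) in cofinite, ρ.IsUnramifiedAt v) ∧ ∀ (v : IsDedekindDomain.HeightOneSpectrum (NumberField.RingOfIntegers K)) (hv : ((ℓ : ℕ) : NumberField.RingOfIntegers K) ∈ v.asIdeal), (Literature.NumberTheory.PAdicHodge.fontainePstAdicCompletion v ℓ hv).IsDeRhamFramed (ρ.toLocal v)) → (∀ (v : IsDedekindDomain.HeightOneSpectrum (NumberField.RingOfIntegers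 K)) (hv : ((ℓ : ℕ) : NumberField.RingOfIntegers K) ∈ v.asIdeal), (Literature.NumberTheory.PAdicHodge.fontainePstAdicCompletion v ℓ hv).IsCrystallineFramed (ρ.toLocal v)) → (∀ w : IsDedekindDomain.HeightOneSpectrum (NumberField.RingOfIntegers K), ((ℓ : ℕ) : NumberField.RingOfIntegers K) ∉ w.asIdeal → ρ.IsUnramifiedAt w) → ∀ (ι₂ : PadicAlgCl 2 ≃+* ℂ), ∃ (L : Type) (_ : Field L) (_ : NumberField L) (_ : Algebra K L) (_ : IsGalois K L), ∀ (M : Type) [Field M] [NumberField M] [Algebra K M] [Algebra M L] [IsScalarTower K M L], IsSolvable (L ≃ₐ[M] L) → ((∀ᶠ w : IsDedekindDomain.HeightOneSpectrum (NumberField.RingOfIntegers M) in cofinite, (ρ.restrictField M).IsUnramifiedAt w) ∧ ∀ (w : IsDedekindDomain.HeightOneSpectrum (NumberField.RingOfIntegers M)) (hw : ((ℓ : ℕ) : NumberField.RingOfIntegers M) ∈ w.asIdeal), (Literature.NumberTheory.PAdicHodge.fontainePstAdicCompletion w ℓ hw).IsDeRhamFramed ((ρ.restrictField M).toLocal w))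 → (∀ (w : IsDedekindDomain.HeightOneSpectrum (NumberField.RingOfIntegers M)) (hw : ((ℓ : ℕ) : NumberField.RingOfIntegers M) ∈ w.asIdeal), (Literature.NumberTheory.PAdicHodge.fontainePstAdicCompletion w ℓ hw).IsCrystallineFramed ((ρ.restrictField M).toLocal w)) → (∀ w : IsDedekindDomain.HeightOneSpectrum (NumberField.RingOfIntegers M), ((ℓ : ℕ) : NumberField.RingOfIntegers M) ∉ w.asIdeal → (ρ.restrictField M).IsUnramifiedAt w) → ∃ ρ₂ : Literature.NumberTheory.GaloisRepresentations.FramedGaloisRep M (PadicAlgCl 2) n, (∀ᶠ w : IsDedekindDomain.HeightOneSpectrum (NumberField.RingOfIntegers M) in cofinite, ρ₂.IsUnramifiedAt w) ∧ (∀ᶠ w : IsDedekindDomain.HeightOneSpectrum (NumberField.RingOfIntegers M) in cofinite, ∃ α : Multiset ℂ, (ρ.restrictField M).HasFrobCharpolyAt w (Literature.NumberTheory.Automorphic.arithFrobPolyOfSatake ι w.residueCard 1 α) ∧ ρ₂.HasFrobCharpolyAt w (Literature.NumberTheory.Automorphic.arithFrobPolyOfSatake ι₂ w.residueCard 1 α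))

/-- [support · PRINT · BT · ATTACKABLE NOW (pure representation theory of profinite groups + Chebotarev; Lean size XL: Brauer's
induction theorem and the Grothendieck group of continuous semisimple representations are not in Mathlib; tree ingredients:
`FramedGaloisRep.induce`, `eventually_hasFrobCharpolyAt_induce`, `exists_conj_of_match`, `eventually_common_of_match`,
`FramedGaloisRep.exists_restrictField_apply_eq_pow`) · sources: BLGGT arXiv:1010.2561 §5.4 «the Brauer item» p. 39 and the proof
of Thm 5.4.1 p. 40; HSBT Ann. Math. 171 (2010) proof of Thm 4.2; Brauer 1947; Serre *Linear representations* §10 Thm 19; Curtis–Reiner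
*Methods* I §10 (Mackey) · tightness: the irreducibility hypothesis (b) cannot be dropped — with reducible layer companions the
virtual A need not be effective (instrument ask I-g11.1)]
BRAUER–TAYLOR DESCENT OF DYADIC COMPANIONS: ρ : Γ_K → GL_n(ℚ̄_ℓ) continuous, L/K finite Galois; if (a) on every solvable layer
K ⊆ M ⊆ L the restriction ρ|Γ_M has an a.e.-unramified 2-adic companion through (ι, ι₂) and (b) every a.e.-unramified 2-adic companion
of ρ|Γ_L through (ι, ι₂) is irreducible, then ρ has an a.e.-unramified 2-adic companion through (ι, ι₂) over K. -/
def BrauerTaylorDescent : Prop :=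
  ∀ (K : Type) [Field K] [NumberField K] (n : ℕ) (ℓ : ℕ) [Fact ℓ.Prime] (ι : PadicAlgCl ℓ ≃+* ℂ) (ι₂ : PadicAlgCl 2 ≃+* ℂ) (ρ : Literature.NumberTheory.GaloisRepresentations.FramedGaloisRep K (PadicAlgCl ℓ) n) (L : Type) [Field L] [NumberField L] [Algebra K L] [IsGalois K L], (∀ (M : Type) [Field M] [NumberField M] [Algebra K M] [Algebra M L] [IsScalarTower K M L], IsSolvable (L ≃ₐ[M] L) → ∃ ρ₂ : Literature.NumberTheory.GaloisRepresentations.FramedGaloisRep M (PadicAlgCl 2) n, (∀ᶠ w : IsDedekindDomain.HeightOneSpectrum (NumberField.RingOfIntegers M) in cofinite, ρ₂.IsUnramifiedAt w) ∧ (∀ᶠ w : IsDedekindDomain.HeightOneSpectrum (NumberField.RingOfIntegers M) in cofinite, ∃ α : Multiset ℂ, (ρ.restrictField M).HasFrobCharpolyAt w (Literature.NumberTheory.Automorphic.arithFrobPolyOfSatake ι w.residueCard 1 α) ∧ ρ₂.HasFrobCharpolyAt w (Literature.NumberTheory.Automorphic.arithFrobPolyOfSatake ι₂ w.residueCard 1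 α))) → (∀ σ₂ : Literature.NumberTheory.GaloisRepresentations.FramedGaloisRep L (PadicAlgCl 2) n, (∀ᶠ w : IsDedekindDomain.HeightOneSpectrum (NumberField.RingOfIntegers L) in cofinite, σ₂.IsUnramifiedAt w) → (∀ᶠ w : IsDedekindDomain.HeightOneSpectrum (NumberField.RingOfIntegers L) in cofinite, ∃ α : Multiset ℂ, (ρ.restrictField L).HasFrobCharpolyAt w (Literature.NumberTheory.Automorphic.arithFrobPolyOfSatake ι w.residueCard 1 α) ∧ σ₂.HasFrobCharpolyAt w (Literature.NumberTheory.Automorphic.arithFrobPolyOfSatake ι₂ w.residueCard 1 α)) → σ₂.toGaloisRep.IsIrreducible) → ∃ ρ₂ : Literature.NumberTheory.GaloisRepresentations.FramedGaloisRep K (PadicAlgCl 2) n, (∀ᶠ v : IsDedekindDomain.HeightOneSpectrum (NumberField.RingOfIntegers K) in cofinite, ρ₂.IsUnramifiedAt v) ∧ (∀ᶠ v : IsDedekindDomain.HeightOneSpectrum (NumberField.RingOfIntegers K) in cofinite, ∃ α : Multiset ℂ, ρ.HasFrobCharpolyAt v (Literature.NumberTheory.Automorphic.arithFrobPolyOfSatake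 ι v.residueCard 1 α) ∧ ρ₂.HasFrobCharpolyAt v (Literature.NumberTheory.Automorphic.arithFrobPolyOfSatake ι₂ v.residueCard 1 α))

/-- [support · PRINT · HER · KERNEL modulo the NAMED Literature facts `Literature.NumberTheory.PAdicHodge.DeRhamBaseChange`
(Brinon–Conrad 2009 Prop. 6.3.8) and `Literature.NumberTheory.PAdicHodge.CrystallineBaseChange` (Fontaine 1994 Exp. VIII §2.3.7 /
Exp. III §5.1): `levelOneHeredity_of_baseChange` below · the a.e.-unramified and unramified-away-from-ℓ clauses are tree theorems
(`FramedGaloisRep.isUnramifiedAt_restrictField`, `eventually_natCast_notMem`)]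
LEVEL-ONE HEREDITY: if ρ : Γ_K → GL_n(ℚ̄_ℓ) is pinned-geometric (a.e. unramified, de Rham above ℓ for Fontaine's pinned data),
crystalline above ℓ and unramified away from ℓ, then so is its restriction ρ|Γ_L to every number field L ⊇ K (for the pinned data of
the places of L). -/
def LevelOneHeredity : Prop :=
  ∀ (K : Type) [Field K] [NumberField K] (L : Type) [Field L] [NumberField L] [Algebra K L] (n : ℕ) (ℓ : ℕ) [Fact ℓ.Prime] (ρ : Literature.NumberTheory.GaloisRepresentations.FramedGaloisRep K (PadicAlgCl ℓ) n), ((∀ᶠ v : IsDedekindDomain.HeightOneSpectrum (NumberField.RingOfIntegers K) in cofinite, ρ.IsUnramifiedAt v) ∧ ∀ (v : IsDedekindDomain.HeightOneSpectrum (NumberField.RingOfIntegers K)) (hv : ((ℓ : ℕ) : NumberField.RingOfIntegers K) ∈ v.asIdeal), (Literature.NumberTheory.PAdicHodge.fontainePstAdicCompletion v ℓ hv).IsDeRhamFramed (ρ.toLocal v)) → (∀ (v : IsDedekindDomain.HeightOneSpectrum (NumberField.RingOfIntegers K)) (hv : ((ℓ : ℕ) : NumberField.RingOfIntegers K) ∈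 v.asIdeal), (Literature.NumberTheory.PAdicHodge.fontainePstAdicCompletion v ℓ hv).IsCrystallineFramed (ρ.toLocal v)) → (∀ w : IsDedekindDomain.HeightOneSpectrum (NumberField.RingOfIntegers K), ((ℓ : ℕ) : NumberField.RingOfIntegers K) ∉ w.asIdeal → ρ.IsUnramifiedAt w) → (((∀ᶠ w : IsDedekindDomain.HeightOneSpectrum (NumberField.RingOfIntegers L) in cofinite, (ρ.restrictField L).IsUnramifiedAt w) ∧ ∀ (w : IsDedekindDomain.HeightOneSpectrum (NumberField.RingOfIntegers L)) (hw : ((ℓ : ℕ) : NumberField.RingOfIntegers L) ∈ w.asIdeal), (Literature.NumberTheory.PAdicHodge.fontainePstAdicCompletion w ℓ hw).IsDeRhamFramed ((ρ.restrictField L).toLocal w)) ∧ (∀ (w : IsDedekindDomain.HeightOneSpectrum (NumberField.RingOfIntegers L)) (hw : ((ℓ : ℕ) : NumberField.RingOfIntegers L) ∈ w.asIdeal), (Literature.NumberTheory.PAdicHodge.fontainePstAdicCompletion w ℓ hw).IsCrystallineFramed ((ρ.restrictField L).toLocal w)) ∧ (∀ w : IsDedekindDomain.HeightOneSpectrum (NumberField.RingOfIntegers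 L), ((ℓ : ℕ) : NumberField.RingOfIntegers L) ∉ w.asIdeal → (ρ.restrictField L).IsUnramifiedAt w))

/-- [support · CI · GALOIS SIDE · WEAKER than G ∧ I by logic (`towerCompanionIrreducibility_of_GI`: G over L makes an a.e.-unramified
companion of the irreducible level-one ρ|Γ_L de Rham above 2, I over L makes it irreducible) and than the summit (`…_of_langlands`) ·
GUARDED by the level-one hypotheses of ρ|Γ_L (supplied by HER in the closes) · filed so that a re-split of E can cite it without reaching
for the sibling crux I = stmt-Langlands-31934; closes the moment G (31994) and I (31934) close · PRINT wherever I is (regular / Hodge–Tate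
distinct weights: Patrikis–Taylor irreducibility of companions in the polarizable regular sector; Calegari–Gee n ≤ 5 partial)]
TOWER COMPANION IRREDUCIBILITY: for ρ : Γ_K → GL_n(ℚ̄_ℓ) irreducible, Lie-irreducible, level one (ℓ odd), every number field L ⊇ K on
which ρ|Γ_L is level one and every ι₂: every a.e.-unramified 2-adic companion of ρ|Γ_L through (ι, ι₂) is irreducible. -/
def TowerCompanionIrreducibility : Prop :=
  ∀ (K : Type) [Field K] [NumberField K] (n : ℕ), 0 < n → ∀ (ℓ : ℕ) [Fact ℓ.Prime], ℓ ≠ 2 → ∀ (ι : PadicAlgCl ℓ ≃+* ℂ) (ρ : Literature.NumberTheory.GaloisRepresentations.FramedGaloisRep K (PadicAlgCl ℓ) n), ρ.toGaloisRep.IsIrreducible → (∀ (L : Type) [Field L] [NumberField L] [Algebra K L], (ρ.restrictField L).toGaloisRep.IsIrreducible) → ((∀ᶠ v : IsDedekindDomain.HeightOneSpectrum (NumberField.RingOfIntegers K) in cofinite, ρ.IsUnramifiedAt v) ∧ ∀ (v : IsDedekindDomain.HeightOneSpectrum (NumberField.RingOfIntegers K)) (hv : ((ℓ : ℕ) : NumberField.RingOfIntegers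 K) ∈ v.asIdeal), (Literature.NumberTheory.PAdicHodge.fontainePstAdicCompletion v ℓ hv).IsDeRhamFramed (ρ.toLocal v)) → (∀ (v : IsDedekindDomain.HeightOneSpectrum (NumberField.RingOfIntegers K)) (hv : ((ℓ : ℕ) : NumberField.RingOfIntegers K) ∈ v.asIdeal), (Literature.NumberTheory.PAdicHodge.fontainePstAdicCompletion v ℓ hv).IsCrystallineFramed (ρ.toLocal v)) → (∀ w : IsDedekindDomain.HeightOneSpectrum (NumberField.RingOfIntegers K), ((ℓ : ℕ) : NumberField.RingOfIntegers K) ∉ w.asIdeal → ρ.IsUnramifiedAt w) → ∀ (L : Type) [Field L] [NumberField L] [Algebra K L] (ι₂ : PadicAlgCl 2 ≃+* ℂ), ((∀ᶠ w : IsDedekindDomain.HeightOneSpectrum (NumberField.RingOfIntegers L) in cofinite, (ρ.restrictField L).IsUnramifiedAt w) ∧ ∀ (w : IsDedekindDomain.HeightOneSpectrum (NumberField.RingOfIntegers L)) (hw : ((ℓ : ℕ) : NumberField.RingOfIntegers L) ∈ w.asIdeal), (Literature.NumberTheory.PAdicHodge.fontainePstAdicCompletion w ℓ hw).IsDeRhamFramed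 ((ρ.restrictField L).toLocal w)) → (∀ (w : IsDedekindDomain.HeightOneSpectrum (NumberField.RingOfIntegers L)) (hw : ((ℓ : ℕ) : NumberField.RingOfIntegers L) ∈ w.asIdeal), (Literature.NumberTheory.PAdicHodge.fontainePstAdicCompletion w ℓ hw).IsCrystallineFramed ((ρ.restrictField L).toLocal w)) → (∀ w : IsDedekindDomain.HeightOneSpectrum (NumberField.RingOfIntegers L), ((ℓ : ℕ) : NumberField.RingOfIntegers L) ∉ w.asIdeal → (ρ.restrictField L).IsUnramifiedAt w) → ∀ σ₂ : Literature.NumberTheory.GaloisRepresentations.FramedGaloisRep L (PadicAlgCl 2) n, (∀ᶠ w : IsDedekindDomain.HeightOneSpectrum (NumberField.RingOfIntegers L) in cofinite, σ₂.IsUnramifiedAt w) → (∀ᶠ w : IsDedekindDomain.HeightOneSpectrum (NumberField.RingOfIntegers L) in cofinite, ∃ α : Multiset ℂ, (ρ.restrictField L).HasFrobCharpolyAt w (Literature.NumberTheory.Automorphic.arithFrobPolyOfSatake ι w.residueCard 1 α) ∧ σ₂.HasFrobCharpolyAt w (Literature.NumberTheory.Automorphic.arithFrobPolyOfSatake ι₂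 w.residueCard 1 α)) → σ₂.toGaloisRep.IsIrreducible

/-! ## Bridges: the one-line texts ARE the vocabulary forms (`Iff.rfl`) -/

section Bridges

/-- PC in vocabulary form. [bookkeeping] -/
theorem potentialCompanions_iff : PotentialCompanions ↔
    (∀ (K : Type) [Field K] [NumberField K] (n : ℕ), 0 < n → ∀ (ℓ : ℕ) [Fact ℓ.Prime], ℓ ≠ 2 →
      ∀ (ι : PadicAlgCl ℓ ≃+* ℂ) (ρ : FramedGaloisRep K (PadicAlgCl ℓ) n), ρ.toGaloisRep.IsIrreducible →
        IsLieIrreducible ρ → IsPinnedGeometric ρ → IsCrystallineAbove ρ → IsUnramifiedAwayFrom ρ →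
          ∀ (ι₂ : PadicAlgCl 2 ≃+* ℂ), ∃ (L : Type) (_ : Field L) (_ : NumberField L) (_ : Algebra K L) (_ : IsGalois K L),
            GuardedLayerCompanions ι ι₂ ρ L) :=
  Iff.rfl

/-- BT in vocabulary form. [bookkeeping] -/
theorem brauerTaylorDescent_iff : BrauerTaylorDescent ↔
    (∀ (K : Type) [Field K] [NumberField K] (n : ℕ) (ℓ : ℕ) [Fact ℓ.Prime] (ι : PadicAlgCl ℓ ≃+* ℂ) (ι₂ : PadicAlgCl 2 ≃+* ℂ)
      (ρ : FramedGaloisRep K (PadicAlgCl ℓ) n) (L : Type) [Field L] [NumberField L] [Algebra K L] [IsGalois K L],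
        LayerCompanions ι ι₂ ρ L → CompanionsIrreducible ι ι₂ (ρ.restrictField L) → HasDyadicCompanion ι ι₂ ρ) :=
  Iff.rfl

/-- CI in vocabulary form. [bookkeeping] -/
theorem towerCompanionIrreducibility_iff : TowerCompanionIrreducibility ↔
    (∀ (K : Type) [Field K] [NumberField K] (n : ℕ), 0 < n → ∀ (ℓ : ℕ) [Fact ℓ.Prime], ℓ ≠ 2 →
      ∀ (ι : PadicAlgCl ℓ ≃+* ℂ) (ρ : FramedGaloisRep K (PadicAlgCl ℓ) n), ρ.toGaloisRep.IsIrreducible →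
        IsLieIrreducible ρ → IsPinnedGeometric ρ → IsCrystallineAbove ρ → IsUnramifiedAwayFrom ρ →
          ∀ (L : Type) [Field L] [NumberField L] [Algebra K L] (ι₂ : PadicAlgCl 2 ≃+* ℂ),
            IsPinnedGeometric (ρ.restrictField L) → IsCrystallineAbove (ρ.restrictField L) → IsUnramifiedAwayFrom (ρ.restrictField L) →
              CompanionsIrreducible ι ι₂ (ρ.restrictField L)) :=
  Iff.rfl

/-- HER in vocabulary form. [bookkeeping] -/
theorem levelOneHeredity_iff : LevelOneHeredity ↔
    (∀ (K : Type) [Field K] [NumberField K] (L : Type) [Field L] [NumberField L] [Algebra K L] (n : ℕ) (ℓ : ℕ) [Fact ℓ.Prime]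
      (ρ : FramedGaloisRep K (PadicAlgCl ℓ) n), IsPinnedGeometric ρ → IsCrystallineAbove ρ → IsUnramifiedAwayFrom ρ →
        IsLevelOne (ρ.restrictField L)) :=
  Iff.rfl

end Bridges

/-! ## KERNEL 0 — HER is a theorem modulo the two named base-change facts of `Literature/NumberTheory/PAdicHodge` -/

section Heredity

variable {K : Type} [Field K] [NumberField K] {ℓ : ℕ} [Fact ℓ.Prime] {n : ℕ}

/-- Unramified away from ℓ passes to `ρ|Γ_L` (tree: `FramedGaloisRep.isUnramifiedAt_restrictField`). -/
theorem isUnramifiedAwayFrom_restrictField (ρ : FramedGaloisRep K (PadicAlgCl ℓ) n) (h : IsUnramifiedAwayFrom ρ)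
    (L : Type) [Field L] [NumberField L] [Algebra K L] : IsUnramifiedAwayFrom (ρ.restrictField L) := by
  intro w hw
  haveI := liesOver_under (F := K) w
  have hv : ((ℓ : ℕ) : 𝓞 K) ∉ (w.under (𝓞 K)).asIdeal := fun h' =>
    hw ((natCast_mem_asIdeal_iff_of_liesOver (w.under (𝓞 K)) w ℓ).2 h')
  exact ρ.isUnramifiedAt_restrictField (v := w.under (𝓞 K)) (w := w) rfl (h _ hv)

/-- A representation unramified away from ℓ is a.e. unramified (finitely many places above ℓ). -/
theorem eventually_isUnramifiedAt_of_awayFrom {L : Type} [Field L] [NumberField L] (σ : FramedGaloisRep L (PadicAlgCl ℓ) n)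
    (h : IsUnramifiedAwayFrom σ) : ∀ᶠ w : HeightOneSpectrum (𝓞 L) in cofinite, σ.IsUnramifiedAt w :=
  (eventually_natCast_notMem L ℓ (Nat.Prime.ne_zero (Fact.out))).mono fun w hw => h w hw

/-- **HER ⟸ DeRhamBaseChange ∧ CrystallineBaseChange** (the two NAMED Literature facts; everything else is tree plumbing).  `hcr` is
VERBATIM the statement of `Literature.NumberTheory.PAdicHodge.CrystallineBaseChange` (module `Literature/NumberTheory/PAdicHodge/
CrystallineBaseChange.lean`, not imported only because it was unbuilt on the farm on 2026-08-30); `hdR` is the imported named fact. -/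
theorem levelOneHeredity_of_baseChange (hdR : DeRhamBaseChange)
    (hcr : ∀ (ℓ : ℕ) [Fact ℓ.Prime] (K L : Type) [Field K] [ValuativeRel K] [TopologicalSpace K]
      [IsNonarchimedeanLocalField K] [CharZero K] [Field L] [ValuativeRel L] [TopologicalSpace L]
      [IsNonarchimedeanLocalField L] [CharZero L] [Algebra K L], Continuous (algebraMap K L) →
      ∀ (hK : ValuativeRel.valuation K (ℓ : K) < 1) (hL : ValuativeRel.valuation L (ℓ : L) < 1) (n : ℕ)
        (ρ : Literature.NumberTheory.GaloisRepresentations.FramedRep (Field.absoluteGaloisGroup K) (PadicAlgCl ℓ) n),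
        (Literature.NumberTheory.PAdicHodge.fontainePst K ℓ hK).IsCrystallineFramed ρ →
          (Literature.NumberTheory.PAdicHodge.fontainePst L ℓ hL).IsCrystallineFramed
            (ρ.comp (Literature.NumberTheory.GaloisRepresentations.absGaloisRestrict K L))) :
    LevelOneHeredity := by
  rw [levelOneHeredity_iff]
  intro K _ _ L _ _ _ n ℓ _ ρ hgeo hcrys hlvl
  have hlvlL : IsUnramifiedAwayFrom (ρ.restrictField L) := isUnramifiedAwayFrom_restrictField ρ hlvl L
  refine ⟨⟨eventually_isUnramifiedAt_of_awayFrom _ hlvlL, fun w hw => ?_⟩, fun w hw => ?_, hlvlL⟩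
  · exact isDeRhamFramed_toLocal_restrictField hdR ρ hgeo.2 w hw
  · exact isCrystallineFramed_toLocal_restrictField (fun K' L' => hcr ℓ K' L') ρ hcrys w hw

end Heredity

end Summit.Langlands.Langlands.Theorems.LevelOneDyadic.Potential
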